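import Summits.Ventures.PercRepro.Night2LocalD3ThreeTwo

/-!
# PercRepro — the cell `(a, k) = (3, 2)` at `|E ∖ G| = 3`, `q = 4`: the far sets whose non-`K` coloop deletion is no member (night-2, gen 12)

Sequel of `Night2LocalD3ThreeTwo.lean` (`coloops S = K ∪ {x}`, `|S| = 6`, at most one fat member):

* a fat member forces `S ∖ x ∉ U_G` (`not_erase_mem_Uq_of_fat`: `ρ((G ∖ S) ∪ {x}) ≤ 2`, so `E ∖ (S ∖ x) ⊆ (G ∖ S) ∪ {x} ∪ (E ∖ G)` has
  rank `≤ 5`);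
* when `S ∖ x ∉ U_G` the set `S` has no covering preimage outside layer 0 (`L1_eq_zero_of_not_erase_mem_Uq`), so
  `cap₂(S) ≥ 1 − 3·k1/10 ≥ 2/5`, and `load₂ ≤ 16/75 + 2·4/45 = 88/225 ≤ 2/5` (`load2_le_cap2_three_two_of_not_erase_mem_Uq`).

What remains of the cell `(3, 2)`: the far sets with `S ∖ x ∈ U_G` (all three members thin) — the tight case of
`proofs/NIGHT-2-dq3.md` §5.5.
-/

open scoped Matroid

namespace PercRepro.Shadow

open Finset PerFlat ThmH

variable {α : Type*} [DecidableEq α] {M : Matroid α} [M.Finite]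

section ThreeTwoB

variable {G S : Finset α}

open scoped Classical in
/-- **A fat member forces `S ∖ x ∉ U_G`** (`coloops S = K ∪ {x}`, two coloops of `M|G`): the points of `G ∖ S` lie in
`cl B` with `B ⊇ K ∪ {x}`, so `ρ((G ∖ S) ∪ {x}) ≤ ρ(B) − |K| = 2`, and `E ∖ (S ∖ x) ⊆ (G ∖ S) ∪ {x} ∪ (E ∖ G)` has rank `≤ 5`. -/
theorem not_erase_mem_Uq_of_fat (hG : G ∈ flatsQ M (4 + 1)) (hd : (gr M \ G).card = 3) (hk : kColoops M G = 2)
    (hS : S ∈ shadowAt M (4 + 2) 4 (Uq M (4 + 2) 4) G) {x : α}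
    (hxK : x ∉ G.filter (fun y => y ∉ clF M (G.erase y)))
    (hcol : coloops M S = insert x (G.filter (fun y => y ∉ clF M (G.erase y)))) {B : Finset α}
    (hB : B ∈ ex2 M 4 G S) (hf : (G \ clF M B).card = 2) : S.erase x ∉ Uq M (4 + 2) 4 := by
  set K := G.filter (fun y => y ∉ clF M (G.erase y)) with hKdef
  have hGg : G ⊆ gr M := (mem_flatsQ.1 hG).1
  have hSG : S ⊆ G := subset_of_mem_shadowAt hS
  obtain ⟨hBm, -, hBS, hsub, hcard⟩ := mem_ex2_unpack hB
  have hBU : B ∈ Uq M (4 + 2) 4 := (mem_membersIn.1 hBm).1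
  have hBcl : B ⊆ clF M B := subset_clF hBU
  have hrB : rkN M B = 4 := by
    have h := (mem_Uq.1 hBU).2.1
    rw [eRk_eq_rkN] at h
    exact_mod_cast h
  have hKc : K.card = 2 := by unfold kColoops at hk; rw [← hKdef] at hk; exact hk
  have hcolB : coloops M S ⊆ B := fun e he => mem_of_mem_ex2_of_mem_coloops hG hS hB he
  have hxS : x ∈ S := coloops_subset_self S (by rw [hcol]; exact Finset.mem_insert_self x _)
  have hxG : x ∈ G := hSG hxS
  -- `G ∖ S ⊆ cl B`
  have hPcl : ∀ p ∈ G, p ∉ S → p ∈ clF M B := by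
    intro p hpG hpS
    by_contra h
    have hmem : p ∈ G \ clF M B := Finset.mem_sdiff.2 ⟨hpG, h⟩
    rw [(Finset.eq_of_subset_of_card_le hsub (by omega)).symm] at hmem
    exact hpS (Finset.mem_sdiff.1 hmem).1
  set X := insert x (G \ S) with hXdef
  have hXG : X ⊆ G := Finset.insert_subset hxG Finset.sdiff_subset
  have hXK : Disjoint K X := by
    rw [Finset.disjoint_insert_right]
    refine ⟨hxK, ?_⟩
    rw [Finset.disjoint_left]
    intro e heK heP
    exact (Finset.mem_sdiff.1 heP).2 (coloops_subset_self S (coloopsG_subset_coloops hS heK))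
  have hKXcl : K ∪ X ⊆ clF M B := by
    intro e he
    rw [Finset.mem_union] at he
    rcases he with heK | heX
    · exact hBcl (hcolB (by rw [hcol]; exact Finset.mem_insert_of_mem heK))
    · rw [hXdef, Finset.mem_insert] at heX
      rcases heX with rfl | heP
      · exact hBcl (hcolB (by rw [hcol]; exact Finset.mem_insert_self _ _))
      · exact hPcl e (Finset.mem_sdiff.1 heP).1 (Finset.mem_sdiff.1 heP).2
  have hrKX : rkN M (K ∪ X) ≤ 4 := by
    have := rkN_mono (M := M) hKXcl
    rwa [rkN_clF, hrB] at this
  have hY : ∀ y ∈ K, y ∈ G ∧ y ∉ clF M (G.erase y) := fun y hy => Finset.mem_filter.1 hy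
  have hrX : rkN M X ≤ 2 := by
    have h := eRk_union_coloops hGg K hY hXG hXK
    rw [eRk_eq_rkN, eRk_eq_rkN] at h
    have h' : rkN M (K ∪ X) = K.card + rkN M X := by exact_mod_cast h
    omega
  intro hmem
  have hr6 : rkN M (gr M \ S.erase x) = 6 := by
    have h := (mem_Uq.1 hmem).2.2
    rw [eRk_eq_rkN] at h
    exact_mod_cast h
  have hsub' : gr M \ S.erase x ⊆ X ∪ (gr M \ G) := by
    intro e he
    rw [Finset.mem_sdiff, Finset.mem_erase, not_and_or, not_not] at he
    rw [Finset.mem_union, hXdef, Finset.mem_insert, Finset.mem_sdiff, Finset.mem_sdiff]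
    by_cases heG : e ∈ G
    · left
      rcases he.2 with rfl | heS
      · exact Or.inl rfl
      · exact Or.inr ⟨heG, heS⟩
    · right
      exact ⟨he.1, heG⟩
  have h1 : rkN M (gr M \ S.erase x) ≤ rkN M (X ∪ (gr M \ G)) := rkN_mono hsub'
  have h2 := rkN_inter_add_rkN_union_le (M := M) X (gr M \ G)
  have h3 : rkN M (gr M \ G) ≤ 3 := hd ▸ rkN_le_card _
  omega

open scoped Classical in
/-- **Without `S ∖ x ∈ U_G`, a far set with `coloops S = K ∪ {x}` has no covering preimage outside layer 0**: a preimage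
`S ∖ z` needs a coloop `z`; `z = x` is excluded, and `z ∈ K` makes `S ∖ z` layer-0 (`cl(S ∖ z) = G ∖ z`). -/
theorem L1_eq_zero_of_not_erase_mem_Uq (hG : G ∈ flatsQ M (4 + 1)) (hd : (gr M \ G).card = 3)
    (hS : S ∈ shadowAt M (4 + 2) 4 (Uq M (4 + 2) 4) G) {x : α}
    (hcol : coloops M S = insert x (G.filter (fun y => y ∉ clF M (G.erase y))))
    (hnot : S.erase x ∉ Uq M (4 + 2) 4) : L1 M 4 G S = 0 := by
  set K := G.filter (fun y => y ∉ clF M (G.erase y)) with hKdef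
  have hGg : G ⊆ gr M := (mem_flatsQ.1 hG).1
  have hSG : S ⊆ G := subset_of_mem_shadowAt hS
  have hGr : rkN M G = 4 + 1 := by
    have h := (mem_flatsQ.1 hG).2.2
    rw [eRk_eq_rkN] at h
    exact_mod_cast h
  unfold L1
  apply Finset.sum_eq_zero
  intro B' hB'
  exfalso
  rw [Finset.mem_filter, mem_coverPreimages, mem_coverSets] at hB'
  obtain ⟨⟨hB'm, z, hz, hzS⟩, hB'0⟩ := hB'
  have hB'U : B' ∈ Uq M (4 + 2) 4 := (mem_membersIn.1 hB'm).1
  have hzB' : z ∉ B' := fun h => (Finset.mem_sdiff.1 hz).2 (subset_clF hB'U h)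
  have hB'eq : B' = S.erase z := by rw [← hzS, Finset.erase_insert hzB']
  have hzcol : z ∈ coloops M S := by
    rw [mem_coloops]
    refine ⟨by rw [← hzS]; exact Finset.mem_insert_self _ _, ?_⟩
    rw [← hB'eq]
    exact (Finset.mem_sdiff.1 hz).2
  rw [hcol, Finset.mem_insert] at hzcol
  rcases hzcol with rfl | hzK
  · exact hnot (hB'eq ▸ hB'U)
  · -- `z ∈ K`: `B' = S ∖ z` is layer-0
    apply hB'0
    rw [mem_lay0]
    refine ⟨hB'm, ?_, by omega⟩
    have hzG : z ∈ G := (Finset.mem_filter.1 hzK).1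
    have hzcl : z ∉ clF M (G.erase z) := (Finset.mem_filter.1 hzK).2
    have hzcolG : z ∈ coloops M G := Finset.mem_filter.2 ⟨hzG, hzcl⟩
    have hrGz : rkN M (G.erase z) = 4 := by
      have := rkN_erase_of_mem_coloops hGg hzcolG
      omega
    have hrB' : rkN M B' = 4 := by
      have h := (mem_Uq.1 hB'U).2.1
      rw [eRk_eq_rkN] at h
      exact_mod_cast h
    have hB'sub : B' ⊆ G.erase z := by
      rw [hB'eq]
      exact Finset.erase_subset_erase z hSG
    have hGz : G.erase z ⊆ clF M B' := by
      have h := subset_closure_of_rkN_eq ((Finset.erase_subset z G).trans hGg) hB'sub (by omega)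
      intro e he
      rw [← Finset.mem_coe, coe_clF]
      exact h (by exact_mod_cast he)
    have hGsub : G \ clF M B' ⊆ {z} := by
      intro e he
      rw [Finset.mem_sdiff] at he
      rw [Finset.mem_singleton]
      by_contra hne
      exact he.2 (hGz (Finset.mem_erase.2 ⟨hne, he.1⟩))
    have hzin : z ∈ G \ clF M B' := by
      refine Finset.mem_sdiff.2 ⟨hzG, ?_⟩
      rw [hB'eq]
      exact (Finset.mem_sdiff.1 hz).2 |> fun h => by rwa [hB'eq] at h
    have h1 : (G \ clF M B').card ≤ 1 := (Finset.card_le_card hGsub).trans (by simp)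
    have h2 : 1 ≤ (G \ clF M B').card := Finset.card_pos.2 ⟨z, hzin⟩
    omega

open scoped Classical in
/-- **The cell `(3, 2)` at the far sets whose `S ∖ x` is not a member**: `load₂ ≤ 16/75 + 2·(4/45) = 88/225 ≤ 2/5 ≤ cap₂`. -/
theorem load2_le_cap2_three_two_of_not_erase_mem_Uq (hs : ∀ e ∈ gr M, ∀ f ∈ gr M, e ≠ f → rkN M {e, f} = 2)
    (hG : G ∈ flatsQ M (4 + 1)) (hd : (gr M \ G).card = 3) (hk : kColoops M G = 2)
    (hS : S ∈ shadowAt M (4 + 2) 4 (Uq M (4 + 2) 4) G) (ha : (coloops M S).card = 3) {x : α}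
    (hcol : coloops M S = insert x (G.filter (fun y => y ∉ clF M (G.erase y))))
    (hnot : S.erase x ∉ Uq M (4 + 2) 4) : load2 M 4 G S ≤ cap2 M 4 G S := by
  have hSG : S ⊆ G := subset_of_mem_shadowAt hS
  have hL1 : L1 M 4 G S = 0 := L1_eq_zero_of_not_erase_mem_Uq hG hd hS hcol hnot
  have hk1 : k1 M 4 G S ≤ 2 := hk ▸ k1_le_kColoops hSG
  have hcapS : capS M 4 G S = 1 - (k1 M 4 G S : ℚ) * (3 / 10) := by
    unfold capS; rw [hd]; unfold phiQ; push_cast; ring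
  have hcap : (2 : ℚ) / 5 ≤ cap2 M 4 G S := by
    unfold cap2
    rw [hL1, mul_zero, sub_zero, hcapS]
    have : (k1 M 4 G S : ℚ) ≤ 2 := by exact_mod_cast hk1
    linarith
  have hw : ∀ B ∈ ex2 M 4 G S,
      w2 M 4 G B S ≤ if (G \ clF M B).card = 2 then (16 : ℚ) / 75 else 4 / 45 := by
    intro B hB
    split_ifs with h2
    · exact w2_le_d3' hG hd hB
    · have hm : 2 ≤ (G \ clF M B).card := by
        obtain ⟨-, -, -, hsub, hcard⟩ := mem_ex2_unpack hB
        exact hcard ▸ Finset.card_le_card hsub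
      exact w2_le_d3_thin hG hd hB (by omega)
  have hload : load2 M 4 G S ≤
      ∑ B ∈ ex2 M 4 G S, (if (G \ clF M B).card = 2 then (16 : ℚ) / 75 else 4 / 45) := by
    unfold load2
    rw [← Finset.sum_filter_ne_zero]
    exact Finset.sum_le_sum (fun B hB => hw B hB)
  rw [Finset.sum_ite, Finset.sum_const, Finset.sum_const, nsmul_eq_mul, nsmul_eq_mul] at hload
  have hex := two_mul_card_ex2_le hG hS
  rw [ha] at hex
  have hfat : ((ex2 M 4 G S).filter (fun B => (G \ clF M B).card = 2)).card ≤ 1 := by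
    rw [Finset.card_le_one]
    intro B₁ hB₁ B₂ hB₂
    rw [Finset.mem_filter] at hB₁ hB₂
    by_contra hne
    exact not_two_fat_of_three_two hs hG hd hk hS ha hB₁.1 hB₂.1 hne hB₁.2 hB₂.2
  have hsplit := Finset.card_filter_add_card_filter_not (s := ex2 M 4 G S) (fun B => (G \ clF M B).card = 2)
  have hthin : ((ex2 M 4 G S).filter (fun B => ¬ (G \ clF M B).card = 2)).card ≤ 3 := by omega
  have hfat' : (((ex2 M 4 G S).filter (fun B => (G \ clF M B).card = 2)).card : ℚ) ≤ 1 := by exact_mod_cast hfat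
  have hthin' : (((ex2 M 4 G S).filter (fun B => ¬ (G \ clF M B).card = 2)).card : ℚ) ≤
      3 - (((ex2 M 4 G S).filter (fun B => (G \ clF M B).card = 2)).card : ℚ) := by
    have h := Nat.cast_le (α := ℚ) |>.2 (show ((ex2 M 4 G S).filter (fun B => ¬ (G \ clF M B).card = 2)).card ≤
      3 - ((ex2 M 4 G S).filter (fun B => (G \ clF M B).card = 2)).card by omega)
    rw [Nat.cast_sub (by omega)] at h
    push_cast at h
    exact h
  have hfat0 : (0 : ℚ) ≤ (((ex2 M 4 G S).filter (fun B => (G \ clF M B).card = 2)).card : ℚ) := by positivity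
  calc load2 M 4 G S ≤ _ := hload
    _ ≤ 2 / 5 := by nlinarith [hfat', hthin', hfat0]
    _ ≤ cap2 M 4 G S := hcap

end ThreeTwoB

end PercRepro.Shadow
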